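import Literature.MathematicalPhysics.QuantumFieldTheory.Balaban1983to89.B9Eq327GreenZdHerm

/-!
# `Balaban1983to89.B9HilbertSchmidtFibreCoordinates` — [Balaban1985BackgroundPropagators] p. 390 «|X|² = tr X*X» and pp. 391–392 «The inner product for
# these matrices is defined by X·Y = tr XY»: τ-ISOMETRIC EUCLIDEAN COORDINATES OF THE FIBRE — for a finite-dimensional C*-algebra `𝔸` with a faithful
# Hermitian functional `τ` there is a linear isomorphism `φ : EuclideanSpace ℂ (Fin n) ≃ₗ[ℂ] 𝔸`, `n = dim_ℂ 𝔸`, carrying the Euclidean inner product to the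
# trace form, `τ((φx)* φy) = ⟪x, y⟫`; the brick through which the pub-balaban NE9 chain's Hilbert-fibre letters (`W`, `φ : W ≃ₗ[ℂ] 𝔸`) and the N06
# junction's trace pairings `Re τ(a* b)` are compared (bridge storey S4-fibre)

statement-level skeleton of published theorems with citation tags; proofs where landed; nothing here is a claim about the
Yang–Mills mass gap

`[Balaban1985BackgroundPropagators]` ("B9", CMP **99** (1985) 389–434) p. 390: *«a norm |X| of a N × N matrix means the Hilbert–Schmidt norm: |X|² =
tr X*X»*; pp. 391–392: *«The adjoints are taken with respect to natural L² scalar products for functions with values in N × N hermitian matrices. The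
inner product for these matrices is defined by X·Y = tr XY. Let us recall that the trace is normalized, i.e., tr 1 = 1»*.  PDF held:
`paper:balaban1985-cmp99-background-propagators` pp. 390–392 (via the tree's `B9AdOrthogonal` docstring, whose render-read quotations these are; re-read
2026-08-28).

CITATION HEADER (lean-in-tree rule).  Cell `pub-ymgap` (YM Track A, HUMAN RULINGS D-0062 ∕ D-0149), node N06 = [B9], width seat `pub-ymgap-dag-n06-w3` (g6),
CLAIM-4 (bus 2026-08-28 14:37Z; bridge storey S4-fibre of LOCATED-BRIDGE 14:27Z).  WHY.  The pub-balaban NE9 chain types [B9] Sect. 3 on `W`-valued lattice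
fields, `W` an ABSTRACT finite-dimensional Hilbert space read in the algebra by a linear `φ : W ≃ₗ[ℂ] 𝔸` (`B9Eq310HessianOperator.adTransportW φ`,
`B9Eq315QTorus.QtorusW … φ`, `B5Eq190FlatCoercivityUniform.flat_coercive_uniform` «for every finite-dimensional Hilbert fibre `W` and algebra reading
`φ`»); its projections are Mathlib `starProjection`s and its `Q†` a Hilbert adjoint.  The N06 junction pairs `𝔸`-valued fields by the trace form
`Re τ(a* b)` (dag-n06-w4's `trForm ∕ formPer`, dag-n06-b's `bondPair ∕ bondPairPer`).  To instantiate an NE9 theorem at the N06 letters one needs a `W` and a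
`φ` for which the two pairings COINCIDE: `⟪x, y⟫_W = τ((φx)* φy)`.  THIS FILE supplies them: `W := EuclideanSpace ℂ (Fin (finrank ℂ 𝔸))` and `φ` the
inverse coordinate map of a τ-orthonormal basis (Gram–Schmidt for the positive definite Hermitian form `τ(a* b)` — Mathlib's `InnerProductSpace.ofCore` +
`stdOrthonormalBasis` used as a LOCAL structure inside the proof, exactly as Mathlib's `Matrix.LDL` and the tree's `B9AdOrthogonal` do; no instance is
declared).  Storeys S2 (`R`) and S3 (`Q`) of the bridge compare projections ∕ adjoints through this `φ`.

WHAT IS PROVED (kernel, 0 sorry, 0 def, 0 instance; [folklore] finite-dimensional linear algebra — the cited sentences are print's pairing).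
* §1 bookkeeping (`FiniteDimensional ℂ 𝔸` from the tree's standing `[FiniteDimensional ℝ 𝔸]` is this seat's `B9Eq336GaugeOrbitConnectedZd.moduleFinite_complex`).
* §2 ★★★ `exists_euclidean_coordinates_of_faithful_trace`: for `τ : 𝔸 →ₗ[ℂ] ℂ` Hermitian (`τ(a*) = conj τ(a)`) and faithful (`Re τ(a*a) > 0`, `a ≠ 0`):
  `∃ φ : EuclideanSpace ℂ (Fin (finrank ℂ 𝔸)) ≃ₗ[ℂ] 𝔸, ∀ x y, τ((φx)* φy) = ⟪x, y⟫_ℂ`.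
* §3 readings for the consumers: ★ `exists_euclidean_coordinates_re` (`Re τ((φx)* φy) = Re ⟪x, y⟫` and `Re τ((φx)* φx) = ‖x‖²`), ★ `exists_euclidean_coordinates_symm`
  (in the algebra: `τ(a* b) = ⟪φ⁻¹a, φ⁻¹b⟫`, `Re τ(a* a) = ‖φ⁻¹a‖²`).

HONEST SCOPE.  Count-neutral helper (`--supports` the K1 item of record): Gram–Schmidt for the trace form, nothing of [B9] estimated or asserted; the tracial
property of `τ` is NOT needed here (it enters only the `Ad`-invariance of the pairing, elsewhere); nothing of the NE9 chain transported yet; Thm 3.11 ∕ 3.3 NOT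
proved; N05 ∕ N06 NOT discharged; K1 NOT closed; one finite `𝕋⁴` programme at fixed `ε`, Bałaban as printed; R4 closes only the conditional finite-`𝕋⁴` rung
`BalabanLadder.UV` — nothing continuum ∕ ℝ⁴ ∕ OS ∕ mass gap ∕ Clay.  Unit `pub-ymgap-dag-n06-w3` (g6), 2026-08-28; NEW file importing `B9Eq327GreenZdHerm` (for the
fibre context of the N06 junction) only; modifies nothing.  Net new unproved facts: 0.
-/

noncomputable section

open scoped BigOperators InnerProductSpace ComplexConjugate

namespace Literature.MathematicalPhysics.QuantumFieldTheory.Balaban1983to89.B9HilbertSchmidtFibreCoordinates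

variable {𝔸 : Type*} [CStarAlgebra 𝔸]

/-! ## §1  Bookkeeping -/

-- NOTE: the tree's standing `[FiniteDimensional ℝ 𝔸]` gives `FiniteDimensional ℂ 𝔸` by this seat's g4
-- `B9Eq336GaugeOrbitConnectedZd.moduleFinite_complex` (not restated here).

/-- `(b* a)* = a* b`. [folklore] -/
private theorem star_star_mul (a b : 𝔸) : star (star b * a) = star a * b := by
  rw [star_mul, star_star]

/-! ## §2  τ-orthonormal Euclidean coordinates -/

/-- ★★★ **τ-ISOMETRIC EUCLIDEAN COORDINATES OF THE FIBRE** ([B9] p. 390 «|X|² = tr X*X», p. 391 «X·Y = tr XY»): for a finite-dimensional C*-algebra `𝔸`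
and a linear functional `τ` that is HERMITIAN (`τ(a*) = conj τ(a)`) and FAITHFUL (`Re τ(a*a) > 0` for `a ≠ 0`), there is a linear isomorphism
`φ : EuclideanSpace ℂ (Fin (finrank ℂ 𝔸)) ≃ₗ[ℂ] 𝔸` with `τ((φx)* (φy)) = ⟪x, y⟫_ℂ` for all `x, y` — the inverse coordinate map of a τ-orthonormal basis
(Gram–Schmidt for the positive definite Hermitian form `(a, b) ↦ τ(a*b)`, run through Mathlib's `InnerProductSpace.ofCore` ∕ `stdOrthonormalBasis` as a
LOCAL structure; no instance declared). [cite: Balaban1985BackgroundPropagators, p.390, pp.391–392] -/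
theorem exists_euclidean_coordinates_of_faithful_trace [FiniteDimensional ℂ 𝔸] (τ : 𝔸 →ₗ[ℂ] ℂ)
    (hτs : ∀ a : 𝔸, τ (star a) = starRingEnd ℂ (τ a)) (hτp : ∀ a : 𝔸, a ≠ 0 → 0 < (τ (star a * a)).re) :
    ∃ φ : EuclideanSpace ℂ (Fin (Module.finrank ℂ 𝔸)) ≃ₗ[ℂ] 𝔸,
      ∀ x y : EuclideanSpace ℂ (Fin (Module.finrank ℂ 𝔸)), τ (star (φ x) * φ y) = ⟪x, y⟫_ℂ := by
  classical
  -- the trace form as an inner-product core on `𝔸` (local structure; the C*-norm instance of `𝔸` is NOT used below)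
  letI core : InnerProductSpace.Core ℂ 𝔸 :=
    { inner := fun a b => τ (star a * b)
      conj_inner_symm := fun a b => by
        show starRingEnd ℂ (τ (star b * a)) = τ (star a * b)
        rw [← hτs, star_star_mul]
      re_inner_nonneg := fun a => by
        show 0 ≤ RCLike.re (τ (star a * a))
        by_cases ha : a = 0
        · rw [ha, mul_zero, map_zero, map_zero]
        · exact (hτp a ha).le
      add_left := fun a b c => by
        show τ (star (a + b) * c) = τ (star a * c) + τ (star b * c)
        rw [star_add, add_mul, map_add]
      smul_left := fun a b r => by
        show τ (star (r • a) * b) = starRingEnd ℂ r * τ (star a * b)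
        rw [star_smul, smul_mul_assoc, map_smul, smul_eq_mul, RCLike.star_def]
      definite := fun a ha => by
        by_contra hne
        have h := hτp a hne
        have ha' : τ (star a * a) = 0 := ha
        rw [ha', Complex.zero_re] at h
        exact lt_irrefl _ h }
  -- shadow the C*-norm LOCALLY by the trace norm (local instances are consulted first)
  letI ng : NormedAddCommGroup 𝔸 := InnerProductSpace.Core.toNormedAddCommGroup (𝕜 := ℂ) (cd := core)
  letI sng : SeminormedAddCommGroup 𝔸 := ng.toSeminormedAddCommGroup
  letI ips : InnerProductSpace ℂ 𝔸 := InnerProductSpace.ofCore core.toCore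
  let b := stdOrthonormalBasis ℂ 𝔸
  refine ⟨b.repr.symm.toLinearEquiv, fun x y => ?_⟩
  have h : ⟪b.repr.symm x, b.repr.symm y⟫_ℂ = ⟪x, y⟫_ℂ := b.repr.symm.inner_map_map x y
  exact h

/-! ## §3  Readings for the consumers -/

/-- ★ **THE REAL PAIRING AND THE NORM IN COORDINATES**: with `φ` as in §2, `Re τ((φx)* φy) = Re ⟪x, y⟫` and `Re τ((φx)* φx) = ‖x‖²` — the summands of
dag-n06-w4's `trForm ∕ formPer` and dag-n06-b's `bondPair ∕ bondPairPer` read in the NE9 chain's Hilbert fibre `W := EuclideanSpace ℂ (Fin n)`.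
[cite: Balaban1985BackgroundPropagators, p.390 («|X|² = tr X*X»), p.391 («⟨A, B⟩ = Σ Re Tr A*B» form of the pairing)] -/
theorem exists_euclidean_coordinates_re [FiniteDimensional ℂ 𝔸] (τ : 𝔸 →ₗ[ℂ] ℂ)
    (hτs : ∀ a : 𝔸, τ (star a) = starRingEnd ℂ (τ a)) (hτp : ∀ a : 𝔸, a ≠ 0 → 0 < (τ (star a * a)).re) :
    ∃ φ : EuclideanSpace ℂ (Fin (Module.finrank ℂ 𝔸)) ≃ₗ[ℂ] 𝔸,
      (∀ x y : EuclideanSpace ℂ (Fin (Module.finrank ℂ 𝔸)), τ (star (φ x) * φ y) = ⟪x, y⟫_ℂ) ∧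
      (∀ x y : EuclideanSpace ℂ (Fin (Module.finrank ℂ 𝔸)), (τ (star (φ x) * φ y)).re = RCLike.re ⟪x, y⟫_ℂ) ∧
      (∀ x : EuclideanSpace ℂ (Fin (Module.finrank ℂ 𝔸)), (τ (star (φ x) * φ x)).re = ‖x‖ ^ 2) := by
  obtain ⟨φ, hφ⟩ := exists_euclidean_coordinates_of_faithful_trace τ hτs hτp
  refine ⟨φ, hφ, fun x y => by rw [hφ]; rfl, fun x => ?_⟩
  rw [hφ, ← inner_self_eq_norm_sq (𝕜 := ℂ) x]
  rfl

/-- ★ **THE TRACE FORM IN THE ALGEBRA IS THE EUCLIDEAN FORM OF THE COORDINATES**: `τ(a* b) = ⟪φ⁻¹a, φ⁻¹b⟫` and `Re τ(a* a) = ‖φ⁻¹a‖²` for all `a, b ∈ 𝔸`.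
[cite: Balaban1985BackgroundPropagators, p.390, pp.391–392] -/
theorem exists_euclidean_coordinates_symm [FiniteDimensional ℂ 𝔸] (τ : 𝔸 →ₗ[ℂ] ℂ)
    (hτs : ∀ a : 𝔸, τ (star a) = starRingEnd ℂ (τ a)) (hτp : ∀ a : 𝔸, a ≠ 0 → 0 < (τ (star a * a)).re) :
    ∃ φ : EuclideanSpace ℂ (Fin (Module.finrank ℂ 𝔸)) ≃ₗ[ℂ] 𝔸,
      (∀ a b : 𝔸, τ (star a * b) = ⟪φ.symm a, φ.symm b⟫_ℂ) ∧ (∀ a : 𝔸, (τ (star a * a)).re = ‖φ.symm a‖ ^ 2) := by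
  obtain ⟨φ, hφ, -, hn⟩ := exists_euclidean_coordinates_re τ hτs hτp
  refine ⟨φ, fun a b => ?_, fun a => ?_⟩
  · rw [← hφ, LinearEquiv.apply_symm_apply, LinearEquiv.apply_symm_apply]
  · rw [← hn, LinearEquiv.apply_symm_apply]

end Literature.MathematicalPhysics.QuantumFieldTheory.Balaban1983to89.B9HilbertSchmidtFibreCoordinates

end
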